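import Summits.HodgeConjecture.HodgeConjecture.Theses.AnchorTransport
import Summits.HodgeConjecture.HodgeConjecture.Theses.KuznetsovCYFactory
import Summits.HodgeConjecture.HodgeConjecture.Theorems.AnchorTransportTargetIffHodgeConjecture
import Summits.HodgeConjecture.HodgeConjecture.Theorems.AnchorTransportAnchorExistenceTransport
import Summits.HodgeConjecture.HodgeConjecture.Theorems.AnchorTransportAnchorExistenceFloor
import Literature.AlgebraicGeometry.HodgeTheory.GysinFormalismHodgeOfGysin
import Literature.AlgebraicGeometry.HodgeTheory.ComplexConjugation
import Literature.AlgebraicTopology.SingularHomology.SphereLikeCupForm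
import Literature.AlgebraicGeometry.Motives.VarietiesProjectiveSpaceProofs
import Literature.AlgebraicGeometry.Motives.ProjectiveSpaceFieldPointsBijective
import Summits.HodgeConjecture.HodgeConjecture.Theorems.AnchorExistence.Negative.LoadBearing

/-!
# Disproof of `AnchorExistence` (crux stmt-HodgeConjecture-1077, route AnchorTransport) — findings

Standing disprover's work file (cdisprove, cycle 1).  Prose lives in docstrings; everything else is
kernel-checked unless marked `sorry` (near-misses, §6 only).

LANDED UNDER `Theorems/AnchorExistence/Negative/` (importable): `LoadBearing.lean` (p99047, accepted —
§1 ceiling, §2 forced hypotheses and `anchorExistence_false_without_isRationalClass`);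
`IsotrivialStrengthening.lean` (p100641, accepted — §3 `HC → An⁺` through `X × ℙ¹ ⟶ ℙ¹`);
`ConstantClause.lean` (§3 `s₀ = s₁ ⇔ HC(X,c)`) submitted.  `LoadBearing` is imported here (the ceiling
below is re-exported from it); `IsotrivialStrengthening` is importable once the farm has built it.

FINDINGS (cycle 1)
1. NO UNCONDITIONAL KILL IS POSSIBLE SHORT OF `¬ HodgeConjecture` (§1): `HodgeConjecture → AnchorExistence`
   is a landed theorem (constant family `X ⟶ Spec ℂ`, `s₁ = s₀`;
   `anchorTransport_anchorExistence_of_hodgeConjecture`), so `¬ AnchorExistence ⊢ ¬ HodgeConjecture`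
   (`not_hodgeConjecture_of_not_anchorExistence`); with the other crux `V` the crux is EQUIVALENT to
   the summit (`anchorExistence_iff_hodgeConjecture_of_variationalHodge`).  Pointwise: `(X, c)` is
   anchored as soon as `c` is algebraic (`AnchorDatum.of_mem_algebraicClasses`).
2. LOAD-BEARING HYPOTHESES (§2): both hypotheses on the class are FORCED BY THE CONCLUSION —
   an anchor datum makes `c = e^*(A|_{𝒳_{s₁}})` rational (`AnchorDatum.isRationalClass`) and of type
   `(p,p)` (`AnchorDatum.isOfHodgeType`).  Hence `AnchorExistence` minus `IsRationalClass c` is FALSE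
   unconditionally (`anchorExistence_false_without_isRationalClass`; witness `X = ℙ⁰_ℂ`, `p = 0`,
   `c = i·1 ∈ H⁰`, non-rational because complex conjugation fixes rational classes), and
   `AnchorExistence` minus `IsOfHodgeType` is false as soon as one smooth projective variety carries a
   rational class of degree `2p` not of type `(p,p)` (`anchorExistenceWithoutIsOfHodgeType_false_of`;
   e.g. a K3 or abelian surface, `p = 1` — not constructed on the tree's carriers, §6).
3. THE `∃`-SIDE (§3): forbidding the constant family does NOT separate the crux from the Hodge
   conjecture: the strengthening with `s₁ ≠ s₀` over a positive-dimensional base (`AnchorExistenceDistinct`)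
   is still implied by `HodgeConjecture` through the ISOTRIVIAL family `X × ℙ¹ ⟶ ℙ¹`
   (`anchorExistenceDistinct_of_hodgeConjecture`), and implies the crux back
   (`anchorExistence_of_anchorExistenceDistinct`).  Together with the prover's tightness lemma
   `anchorTransport_mem_algebraicClasses_of_anchor_of_fiberIso` (isotrivial anchors give nothing new)
   this pins the separable content of the crux to anchors whose fibre is NOT compatibly isomorphic to
   `X` — i.e. to the GEOGRAPHY of Hodge loci, which no decl on the tree types yet.
   `IrreducibleSpace S.left` is the one load-bearing constraint of the conclusion (over
   `Spec ℂ ⊔ Spec ℂ` the datum `(X ⊔ X, (c, 0))` anchors everything; not formalised: no coproduct API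
   for `SchemeOver`/`complexBetti`), `Smooth S.hom` is removable by normalising/resolving the base.
4. LINE `Sketch` (§4): its seven stubs are either named facts in print (Lefschetz (1,1), hard
   Lefschetz, Buskin's CM corollary, K3 marking / odd Betti / `Nᵖ ⊆` Hodge coniveau / Hodge index —
   all carry their `IsSmoothProjective`/`IsK3Surface` guards, no junk instance found), HC-sandwiched
   (`anchorExistence_anchor_offK3Squares`, `…_floor_of_ratEnd` = HC for `S × S` with `End_Hdg T = ℚ`),
   or Shimura-variety geography (`…_anchor_of_realMult`: true in print — CM points are dense on the
   RM orthogonal Shimura curve/variety of van Geemen 2008 §3, `dim = dim_K T − 2 ≥ 1` — but needs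
   moduli of lattice-polarised K3 surfaces with level structure as `ℂ`-schemes; no cheap attack).
   No stub is refutable by small models: every carrier is real singular cohomology of complex points.
5. SUMMIT-LEVEL JUNK PROBE (§5): the only way `AnchorExistence` (or HC) could fail "for the wrong
   reason" is an EXOTIC `HodgeModel` enlarging `H^{p,p}` (`IsOfHodgeType` is `∃` over models).  Blocked:
   `IsAnalytification.unique` + naturality of the de Rham family (scalar per degree) — the audit's
   argument; nothing constructible found.  Recorded, not pursued.
-/

noncomputable section

set_option linter.dupNamespace false

open CategoryTheory AlgebraicGeometry
open Literature.AlgebraicGeometry Literature.AlgebraicGeometry.Motives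
  Literature.AlgebraicGeometry.HodgeTheory Literature.AlgebraicTopology.SingularHomology
open Summit.HodgeConjecture.HodgeConjecture.Theses.AnchorTransport
open Summit.HodgeConjecture.HodgeConjecture.Theorems

namespace Summit.HodgeConjecture.HodgeConjecture.Cruxes.AnchorExistence.Disproof


/-! ## §0 The anchor datum of a pair `(X, c)` -/

/-- The conclusion of `AnchorExistence` for ONE pair `(X, c)` (`X` of dimension `n`,
`c ∈ H²ᵖ(X(ℂ); ℂ)`): a smooth projective family `f : 𝒳 ⟶ S` of relative dimension `n` over a smooth
irreducible `ℂ`-scheme, points `s₁ s₀`, an iso `e : X ≅ 𝒳_{s₁}`, a global class `A` fibrewise rational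
of type `(p,p)` with `e^*(A|_{𝒳_{s₁}}) = c` and `A|_{𝒳_{s₀}}` algebraic.  Verbatim the `∃`-body of the
route decl (`anchorExistence_iff` is `Iff.rfl`). [cite: CharlesSchnell2014Notes, Conj. 11.3.1] -/
def AnchorDatum (n p : ℕ) (X : SchemeOver ℂ) (c : complexBetti X (2 * p)) : Prop :=
  ∃ (𝒳 S : SchemeOver ℂ) (f : 𝒳 ⟶ S) (s₁ s₀ : ComplexPoints S) (e : X ≅ fiberOver f s₁)
    (A : complexBetti 𝒳 (2 * p)),
    IsSmoothProjectiveFamily f n ∧ IrreducibleSpace S.left ∧ AlgebraicGeometry.Smooth S.hom ∧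
    (∀ s : ComplexPoints S, IsRationalClass (complexBetti.map (fiberι f s) (2 * p) A) ∧
      IsOfHodgeType n (fiberOver f s) (2 * p) p p (complexBetti.map (fiberι f s) (2 * p) A)) ∧
    complexBetti.map e.hom (2 * p) (complexBetti.map (fiberι f s₁) (2 * p) A) = c ∧
    complexBetti.map (fiberι f s₀) (2 * p) A ∈ algebraicClasses (fiberOver f s₀) p

/-- The crux, read through `AnchorDatum` (definitional). [cite: CharlesSchnell2014Notes, Conj. 11.3.1] -/
theorem anchorExistence_iff :
    AnchorExistence ↔ ∀ ⦃n : ℕ⦄ ⦃X : SchemeOver ℂ⦄, IsSmoothProjective n X →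
      ∀ (p : ℕ) (c : complexBetti X (2 * p)), IsRationalClass c → IsOfHodgeType n X (2 * p) p p c →
        AnchorDatum n p X c :=
  Iff.rfl

namespace AnchorDatum

variable {n p : ℕ} {X : SchemeOver ℂ} {c : complexBetti X (2 * p)}

/-- **An anchored class is rational**: `c = e^*(A|_{𝒳_{s₁}})` and `A|_{𝒳_{s₁}}` is rational
(pull-back of `ℚ`-valued cocycles). [cite: HatcherAT2002, §3.1 p. 198] -/
theorem isRationalClass (h : AnchorDatum n p X c) : IsRationalClass c := by
  obtain ⟨𝒳, S, f, s₁, s₀, e, A, -, -, -, hfib, hAc, -⟩ := h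
  rw [← hAc]
  exact (hfib s₁).1.pullback _

/-- **An anchored class is of type `(p,p)`**: `A|_{𝒳_{s₁}}` is of type `(p,p)` and Hodge types are
transported by isomorphisms of `ℂ`-schemes (`IsOfHodgeType.map_of_iso`).
[cite: VoisinHodgeI2002, §7.1.1] -/
theorem isOfHodgeType (h : AnchorDatum n p X c) : IsOfHodgeType n X (2 * p) p p c := by
  obtain ⟨𝒳, S, f, s₁, s₀, e, A, -, -, -, hfib, hAc, -⟩ := h
  rw [← hAc]
  exact (hfib s₁).2.map_of_iso e

/-- **Algebraic classes are anchored by the constant family** (the landed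
`anchorTransport_anchor_of_mem_algebraicClasses`, restated on `AnchorDatum`): pointwise,
`HC(X, c) ⇒ An(X, c)`. [cite: CharlesSchnell2014Notes, Conj. 11.3.1] -/
theorem of_mem_algebraicClasses (hX : IsSmoothProjective n X) (hc : IsRationalClass c)
    (hpp : IsOfHodgeType n X (2 * p) p p c) (halg : c ∈ algebraicClasses X p) :
    AnchorDatum n p X c :=
  anchorTransport_anchor_of_mem_algebraicClasses hX p c hc hpp halg

/-- **Isotrivial anchors give nothing** (the prover's tightness lemma, pointwise): if the datum's
anchor fibre is compatibly isomorphic to the fibre carrying `c`, then `c` is already algebraic.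
[cite: Fulton1998, §19.1] -/
theorem mem_algebraicClasses_of_fiberIso {𝒳 S : SchemeOver ℂ} (f : 𝒳 ⟶ S)
    (s₁ s₀ : ComplexPoints S) (e : X ≅ fiberOver f s₁) (A : complexBetti 𝒳 (2 * p))
    (hAc : complexBetti.map e.hom (2 * p) (complexBetti.map (fiberι f s₁) (2 * p) A) = c)
    (hs₀ : complexBetti.map (fiberι f s₀) (2 * p) A ∈ algebraicClasses (fiberOver f s₀) p)
    (g : fiberOver f s₁ ≅ fiberOver f s₀)
    (hg : complexBetti.map g.hom (2 * p) (complexBetti.map (fiberι f s₀) (2 * p) A) =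
      complexBetti.map (fiberι f s₁) (2 * p) A) :
    c ∈ algebraicClasses X p :=
  anchorTransport_mem_algebraicClasses_of_anchor_of_fiberIso f s₁ s₀ e A hAc hs₀ g hg

end AnchorDatum

/-! ## §1 Why the crux resists: it is implied by the Hodge conjecture -/

/-- **`HodgeConjecture → AnchorExistence`** (landed: constant family). Consequently every refutation
of the crux is a refutation of the summit statement on the tree's carriers.
[cite: CharlesSchnell2014Notes, Conj. 11.3.1 and Cor. 11.3.6] -/
theorem anchorExistence_of_hodgeConjecture (h : _root_.HodgeConjecture) : AnchorExistence :=
  anchorTransport_anchorExistence_of_hodgeConjecture h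

/-- **`¬ AnchorExistence → ¬ HodgeConjecture`**: the disprover's target is HC-hard from above.
[cite: CharlesSchnell2014Notes, Cor. 11.3.6] -/
theorem not_hodgeConjecture_of_not_anchorExistence (h : ¬ AnchorExistence) :
    ¬ _root_.HodgeConjecture :=
  Summit.HodgeConjecture.HodgeConjecture.Theorems.AnchorExistence.Negative.LoadBearing.not_hodgeConjecture_of_not_anchorExistence
    h

/-- **Modulo the other crux `V`, `AnchorExistence ↔ HodgeConjecture`** (`→`: the route's deciding
theorem `closes` with the proved support items; `←`: constant family).
[cite: CharlesSchnell2014Notes, Conj. 11.3.1 and Cor. 11.3.6] -/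
theorem anchorExistence_iff_hodgeConjecture_of_variationalHodge (hV : VariationalHodge) :
    AnchorExistence ↔ _root_.HodgeConjecture :=
  ⟨fun hAn ↦ closes hV hAn IsoInvariance_holds HodgeModels_holds,
    anchorTransport_anchorExistence_of_hodgeConjecture⟩

/-- **The two cruxes are jointly equivalent to the summit** (`Target ↔ HodgeConjecture`, landed).
[cite: CharlesSchnell2014Notes, Cor. 11.3.6] -/
theorem variationalHodge_and_anchorExistence_iff_hodgeConjecture :
    (VariationalHodge ∧ AnchorExistence) ↔ _root_.HodgeConjecture :=
  anchorTransport_target_iff_hodgeConjecture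

/-! ### The shared copy of the crux in route KuznetsovCYFactory

Item stmt-HodgeConjecture-1077 is wanted by both routes; the two route files carry syntactically
identical bodies, so everything in this file serves `KuznetsovCYFactory.AnchorExistence` verbatim. -/

/-- The two route copies of the crux agree definitionally. [folklore] -/
theorem anchorExistence_iff_kuznetsovCYFactory :
    AnchorExistence ↔ Summit.HodgeConjecture.HodgeConjecture.Theses.KuznetsovCYFactory.AnchorExistence :=
  Iff.rfl

/-- The two route copies of the variational crux agree definitionally (`VariationalHodge` of
AnchorTransport is `VariationalHodgeSmooth` of KuznetsovCYFactory). [folklore] -/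
theorem variationalHodge_iff_kuznetsovCYFactory :
    VariationalHodge ↔
      Summit.HodgeConjecture.HodgeConjecture.Theses.KuznetsovCYFactory.VariationalHodgeSmooth :=
  Iff.rfl

/-! ## §2 Load-bearing hypotheses: each hypothesis on `c` is forced by the conclusion -/

/-- `AnchorExistence` with the hypothesis `IsRationalClass c` DROPPED. [folklore] -/
def AnchorExistenceWithoutIsRationalClass : Prop :=
  ∀ ⦃n : ℕ⦄ ⦃X : SchemeOver ℂ⦄, IsSmoothProjective n X →
    ∀ (p : ℕ) (c : complexBetti X (2 * p)), IsOfHodgeType n X (2 * p) p p c → AnchorDatum n p X c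

/-- `AnchorExistence` with the hypothesis `IsOfHodgeType n X (2p) p p c` DROPPED. [folklore] -/
def AnchorExistenceWithoutIsOfHodgeType : Prop :=
  ∀ ⦃n : ℕ⦄ ⦃X : SchemeOver ℂ⦄, IsSmoothProjective n X →
    ∀ (p : ℕ) (c : complexBetti X (2 * p)), IsRationalClass c → AnchorDatum n p X c

/-- **`i · 1 ∈ H⁰(Y; ℂ)` is not a rational class** on a nonempty space: rational classes are fixed by
complex conjugation (`IsRationalClass.conjClass_eq`), `conj (i·1) = -i·1`, and `m·1 = 0 ⇒ m = 0`
(`constClass_eq_zero_iff`). (Universe `0`: the tree's `constClass_eq_smul_one` has ring and space in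
one universe.) [cite: VoisinHodgeI2002, Cor. 6.12] [cite: HatcherAT2002, §3.1 p. 199] -/
theorem not_isRationalClass_I_smul_one (Y : Type) [TopologicalSpace Y] [Nonempty Y] :
    ¬ IsRationalClass (Complex.I • singularCohomology.one ℂ Y) := by
  intro h
  have h1 := h.conjClass_eq
  rw [conjClass_smul, (isRationalClass_one Y).conjClass_eq, Complex.conj_I] at h1
  -- `h1 : (-i)·1 = i·1`, hence `(i + i)·1 = 0`
  have h2 : (Complex.I + Complex.I) • singularCohomology.one ℂ Y = 0 := by
    have h3 : Complex.I • singularCohomology.one ℂ Y - (-Complex.I) • singularCohomology.one ℂ Y = 0 :=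
      sub_eq_zero.mpr h1.symm
    rwa [← sub_smul, sub_neg_eq_add] at h3
  have h4 : constClass (R := ℂ) ℂ Y (Complex.I + Complex.I) = 0 := by
    rw [constClass_eq_smul_one]
    exact h2
  rw [constClass_eq_zero_iff] at h4
  exact Complex.I_ne_zero (add_self_eq_zero.mp h4)

/-- `ℙ⁰_ℂ` has a complex point (homogeneous coordinate `[1]`). [folklore] -/
theorem nonempty_complexPoints_projectiveSpace_zero :
    Nonempty (ComplexPoints (projectiveSpace 0 ℂ)) :=
  ⟨ProjectiveSpace.pointOfVec ℂ (fun _ ↦ (1 : ℂ)) (by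
    intro h
    exact one_ne_zero (congr_fun h 0))⟩

/-- **`AnchorExistence` without `IsRationalClass c` is FALSE** ("any proof must use rationality",
in the cheap sense that the conclusion forces it): on `X = ℙ⁰_ℂ` (`n = 0`), `p = 0`, the class
`c = i·1 ∈ H⁰(X(ℂ); ℂ)` is of type `(0,0)` (`H^{0,0} = H⁰` in any Hodge model, which exists by
`nonempty_hodgeModel_holds`) but not rational, whereas an anchor datum would make it rational.
[cite: Deligne2000, §1] -/
theorem anchorExistence_false_without_isRationalClass : ¬ AnchorExistenceWithoutIsRationalClass := by
  intro h
  have hX : IsSmoothProjective 0 (projectiveSpace 0 ℂ) := isSmoothProjective_projectiveSpace_holds ℂ 0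
  obtain ⟨A⟩ := nonempty_hodgeModel_holds hX
  haveI := nonempty_complexPoints_projectiveSpace_zero
  have hc : IsOfHodgeType 0 (projectiveSpace 0 ℂ) (2 * 0) 0 0
      (Complex.I • singularCohomology.one ℂ (ComplexPoints (projectiveSpace 0 ℂ))) :=
    isOfHodgeType_zero_zero_zero A _
  exact not_isRationalClass_I_smul_one _ (h hX 0 _ hc).isRationalClass

/-- **`AnchorExistence` without `IsOfHodgeType` is false as soon as some smooth projective variety
carries a rational class of degree `2p` not of type `(p,p)`** (e.g. a transcendental rational class in
`H²` of a K3 or abelian surface: `h^{2,0} ≠ 0`, `ρ < b₂`) — the anchor datum would transport the type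
`(p,p)` of `A|_{𝒳_{s₁}}` to `c`.  The witness is not yet constructible on the tree's carriers (no
smooth projective `X` with a COMPUTED non-`(p,p)` rational class in even degree; see §6).
[cite: VoisinHodgeI2002, §7.1.1 and §11.3] -/
theorem anchorExistenceWithoutIsOfHodgeType_false_of
    (hw : ∃ (n : ℕ) (X : SchemeOver ℂ) (p : ℕ) (c : complexBetti X (2 * p)),
      IsSmoothProjective n X ∧ IsRationalClass c ∧ ¬ IsOfHodgeType n X (2 * p) p p c) :
    ¬ AnchorExistenceWithoutIsOfHodgeType := by
  rintro h
  obtain ⟨n, X, p, c, hX, hc, hpp⟩ := hw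
  exact hpp (h hX p c hc).isOfHodgeType

/-- Conversely both dropped-hypothesis variants FOLLOW from the Hodge conjecture restricted to the
classes they quantify over — i.e. they fail ONLY through the forced hypothesis, not through any
anchor geography: `AnchorExistenceWithoutIsOfHodgeType` is equivalent to "every rational class of even
degree on a smooth projective variety is of type `(p,p)` and algebraic". Recorded as the implication
from `HodgeConjecture` plus the (false) totality hypothesis. [folklore] -/
theorem anchorExistenceWithoutIsOfHodgeType_of (hHC : _root_.HodgeConjecture)
    (hall : ∀ ⦃n : ℕ⦄ ⦃X : SchemeOver ℂ⦄, IsSmoothProjective n X →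
      ∀ (p : ℕ) (c : complexBetti X (2 * p)), IsRationalClass c → IsOfHodgeType n X (2 * p) p p c) :
    AnchorExistenceWithoutIsOfHodgeType :=
  fun _n _X hX p c hc ↦ AnchorDatum.of_mem_algebraicClasses hX hc (hall hX p c hc)
    ((hHC hX).2 p c hc (hall hX p c hc))

/-! ## §3 The `∃`-side: forbidding the constant family does not separate the crux from HC -/

/-- **`AnchorExistence` strengthened by `s₁ ≠ s₀`** (so the constant family over `Spec ℂ` is no longer
a witness and the base is positive-dimensional). [folklore] -/
def AnchorExistenceDistinct : Prop :=
  ∀ ⦃n : ℕ⦄ ⦃X : SchemeOver ℂ⦄, IsSmoothProjective n X →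
    ∀ (p : ℕ) (c : complexBetti X (2 * p)), IsRationalClass c → IsOfHodgeType n X (2 * p) p p c →
      ∃ (𝒳 S : SchemeOver ℂ) (f : 𝒳 ⟶ S) (s₁ s₀ : ComplexPoints S) (e : X ≅ fiberOver f s₁)
        (A : complexBetti 𝒳 (2 * p)),
        s₁ ≠ s₀ ∧ IsSmoothProjectiveFamily f n ∧ IrreducibleSpace S.left ∧
        AlgebraicGeometry.Smooth S.hom ∧
        (∀ s : ComplexPoints S, IsRationalClass (complexBetti.map (fiberι f s) (2 * p) A) ∧
          IsOfHodgeType n (fiberOver f s) (2 * p) p p (complexBetti.map (fiberι f s) (2 * p) A)) ∧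
        complexBetti.map e.hom (2 * p) (complexBetti.map (fiberι f s₁) (2 * p) A) = c ∧
        complexBetti.map (fiberι f s₀) (2 * p) A ∈ algebraicClasses (fiberOver f s₀) p

/-- The strengthening implies the crux (forget `s₁ ≠ s₀`). [folklore] -/
theorem anchorExistence_of_anchorExistenceDistinct (h : AnchorExistenceDistinct) : AnchorExistence := by
  intro n X hX p c hc hpp
  obtain ⟨𝒳, S, f, s₁, s₀, e, A, -, hf, hirr, hsm, hfib, hAc, hs₀⟩ := h hX p c hc hpp
  exact ⟨𝒳, S, f, s₁, s₀, e, A, hf, hirr, hsm, hfib, hAc, hs₀⟩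

/-- Two distinct complex points of `ℙ¹_ℂ`: `[1 : 0] ≠ [1 : 1]` (homogeneous coordinates are unique
up to `ℂˣ`). [cite: Hartshorne1977, II Ex. 2.14] -/
theorem exists_ne_complexPoints_projectiveLine :
    ∃ t₁ t₀ : ComplexPoints (projectiveSpace 1 ℂ), t₁ ≠ t₀ := by
  have h10 : (![1, 0] : Fin 2 → ℂ) ≠ 0 := fun h ↦ by simpa using congr_fun h 0
  have h11 : (![1, 1] : Fin 2 → ℂ) ≠ 0 := fun h ↦ by simpa using congr_fun h 0
  refine ⟨ProjectiveSpace.pointOfVec ℂ ![1, 0] h10, ProjectiveSpace.pointOfVec ℂ ![1, 1] h11,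
    fun hab ↦ ?_⟩
  obtain ⟨r, -, h⟩ := (ProjectiveSpace.pointOfVec_eq_pointOfVec_iff _ _ _ _).mp hab
  have h0 := congr_fun h 0
  have h1 := congr_fun h 1
  simp only [Pi.smul_apply, smul_eq_mul, Matrix.cons_val_zero, Matrix.cons_val_one,
    mul_one, mul_zero] at h0 h1
  exact one_ne_zero h1

/-- **The isotrivial anchor `X × ℙ¹ ⟶ ℙ¹`.** If `c` is ALREADY algebraic on the smooth projective `X`,
then for any smooth irreducible `ℂ`-scheme `T` and any two points `t₁, t₀ ∈ T(ℂ)` the trivial family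
`X × T ⟶ T` (base change of the constant family `X ⟶ Spec ℂ` along `T ⟶ Spec ℂ`,
`Motives.familyPullback`) with the class `pr₁^* c` anchors `(X, c)` at `t₁, t₀`: all fibres are `X`
(`fiberOverFamilyPullbackIso`, `isIso_fiberι_toSpecOver`), the fibre restrictions of `pr₁^* c` are the
transports of `c`, so they are rational, of type `(p,p)`, equal to `c` at `t₁` through the fibre iso,
and algebraic at `t₀` (`IsoInvariance`).  Shape of `anchorTransport_anchor_baseChange`, with the points
kept explicit. [cite: Hartshorne1977, II.3 p. 89] [cite: VoisinHodgeI2002, §7.3.2 and §9.1.1] -/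
theorem anchor_trivialFamily_of_mem_algebraicClasses {n p : ℕ} {X : SchemeOver ℂ}
    (hX : IsSmoothProjective n X) {c : complexBetti X (2 * p)} (hc : IsRationalClass c)
    (hpp : IsOfHodgeType n X (2 * p) p p c) (halg : c ∈ algebraicClasses X p)
    (T : SchemeOver ℂ) (hirr : IrreducibleSpace T.left) (hsm : AlgebraicGeometry.Smooth T.hom)
    (t₁ t₀ : ComplexPoints T) :
    ∃ (e : X ≅ fiberOver (familyPullback.snd (toSpecOver X) (toSpecOver T)) t₁)
      (A : complexBetti (familyPullback (toSpecOver X) (toSpecOver T)) (2 * p)),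
      IsSmoothProjectiveFamily (familyPullback.snd (toSpecOver X) (toSpecOver T)) n ∧
      IrreducibleSpace T.left ∧ AlgebraicGeometry.Smooth T.hom ∧
      (∀ s : ComplexPoints T,
        IsRationalClass (complexBetti.map (fiberι (familyPullback.snd (toSpecOver X) (toSpecOver T)) s)
          (2 * p) A) ∧
        IsOfHodgeType n (fiberOver (familyPullback.snd (toSpecOver X) (toSpecOver T)) s) (2 * p) p p
          (complexBetti.map (fiberι (familyPullback.snd (toSpecOver X) (toSpecOver T)) s) (2 * p) A)) ∧
      complexBetti.map e.hom (2 * p)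
          (complexBetti.map (fiberι (familyPullback.snd (toSpecOver X) (toSpecOver T)) t₁) (2 * p) A) =
        c ∧
      complexBetti.map (fiberι (familyPullback.snd (toSpecOver X) (toSpecOver T)) t₀) (2 * p) A ∈
        algebraicClasses (fiberOver (familyPullback.snd (toSpecOver X) (toSpecOver T)) t₀) p := by
  haveI : ∀ s : AlgPoints (specOver ℂ ℂ) ℂ, IsIso (fiberι (toSpecOver X) s) := isIso_fiberι_toSpecOver
  set f := toSpecOver X with hf_def
  set g := toSpecOver T with hg_def
  -- the fibre isos `X ≅ X_{g(t)}` of the constant family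
  let ι : ∀ t : ComplexPoints T, fiberOver f (AlgPoints.map g t) ≅ X :=
    fun t ↦ asIso (fiberι (toSpecOver X) (AlgPoints.map g t))
  have hfam : IsSmoothProjectiveFamily f n := isSmoothProjectiveFamily_toSpecOver hX
  refine ⟨(ι t₁).symm ≪≫ (fiberOverFamilyPullbackIso f g t₁).symm,
    complexBetti.map (familyPullback.fst f g) (2 * p) c, hfam.familyPullback_snd g, hirr, hsm,
    fun s ↦ ?_, ?_, ?_⟩
  · -- fibrewise rational and of type `(p,p)`: `(pr₁^* c)|_s = ι'^* (ι_s^* c)`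
    rw [anchorTransport_map_fiberι_familyPullback]
    exact ⟨(hc.pullback _).pullback _, (hpp.map_of_iso (ι s)).map_of_iso (fiberOverFamilyPullbackIso f g s)⟩
  · -- at `t₁`: `e^* ((pr₁^* c)|_{t₁}) = c`
    rw [anchorTransport_map_fiberι_familyPullback, Iso.trans_hom, Iso.symm_hom, Iso.symm_hom,
      complexBetti.map_comp]
    change complexBetti.map (ι t₁).inv (2 * p)
        ((complexBetti.map (fiberOverFamilyPullbackIso f g t₁).hom (2 * p) ≫
          complexBetti.map (fiberOverFamilyPullbackIso f g t₁).inv (2 * p))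
          (complexBetti.map (fiberι f (AlgPoints.map g t₁)) (2 * p) c)) = c
    rw [← complexBetti.map_comp, Iso.inv_hom_id, complexBetti.map_id]
    change (complexBetti.map (ι t₁).hom (2 * p) ≫ complexBetti.map (ι t₁).inv (2 * p)) c = c
    rw [← complexBetti.map_comp, Iso.inv_hom_id, complexBetti.map_id]
    rfl
  · -- at `t₀`: algebraic, by transport along the two isos
    rw [anchorTransport_map_fiberι_familyPullback]
    exact anchorTransport_isoInvariance_proof (fiberOverFamilyPullbackIso f g t₀) p _
      (anchorTransport_isoInvariance_proof (ι t₀) p _ halg)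

/-- **`HodgeConjecture → AnchorExistenceDistinct`**: under HC every rational `(p,p)` class is
algebraic, hence anchored at a DIFFERENT point of the positive-dimensional smooth irreducible base
`ℙ¹_ℂ` by the isotrivial family `X × ℙ¹ ⟶ ℙ¹` (`anchor_trivialFamily_of_mem_algebraicClasses`).  So
the strengthening by `s₁ ≠ s₀` is still HC-sandwiched (`HC → AnDistinct → An →(V) HC`): to give the crux
content separable from HC one must constrain the ISOMORPHISM TYPE of the anchor fibre (cf.
`AnchorDatum.mem_algebraicClasses_of_fiberIso`), not the position of `s₀`.
[cite: CharlesSchnell2014Notes, Conj. 11.3.1] [cite: VoisinHodgeI2002, §9.1.1] -/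
theorem anchorExistenceDistinct_of_hodgeConjecture (hHC : _root_.HodgeConjecture) :
    AnchorExistenceDistinct := by
  intro n X hX p c hc hpp
  have halg : c ∈ algebraicClasses X p := (hHC hX).2 p c hc hpp
  have hT : IsSmoothProjective 1 (projectiveSpace 1 ℂ) := isSmoothProjective_projectiveSpace_holds ℂ 1
  haveI := hT.smoothOfRelativeDimension
  haveI := hT.geometricallyIrreducible
  have hirr : IrreducibleSpace (projectiveSpace 1 ℂ).left :=
    GeometricallyIrreducible.irreducibleSpace_of_subsingleton (projectiveSpace 1 ℂ).hom
  have hsm : AlgebraicGeometry.Smooth (projectiveSpace 1 ℂ).hom :=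
    SmoothOfRelativeDimension.smooth 1 _
  obtain ⟨t₁, t₀, ht⟩ := exists_ne_complexPoints_projectiveLine
  obtain ⟨e, A, hf, hirr', hsm', hfib, hAc, hs₀⟩ :=
    anchor_trivialFamily_of_mem_algebraicClasses hX hc hpp halg (projectiveSpace 1 ℂ) hirr hsm t₁ t₀
  exact ⟨_, _, _, t₁, t₀, e, A, ht, hf, hirr', hsm', hfib, hAc, hs₀⟩

/-! Corroboration from a sibling route (not re-proved here): TYPED-anchor complements are HC-hard too.
Route PadicSemiregularLift's support item `HodgeBeyondAnchors` ("HC for every smooth projective `X`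
that is neither an abelian variety nor a Fermat hypersurface") is EQUIVALENT to the Hodge conjecture
modulo named facts — `hodgeBeyondAnchors_iff_hodgeConjecture` in
`Theorems/PadicSemiregularLiftHodgeBeyondAnchorsEquivalence.lean`, via "`X × ℙ¹ × ℙ¹` is never an
anchor" (`…ProductsNotAnchors.lean`).  So repairing the crux by LISTING anchor types and asking the
complement outright relocates HC into the complement (exactly the role of the Sketch line's stub
`anchorExistence_anchor_offK3Squares`); the only non-circular repair is to constrain the deformation
class of `(X, c)` itself (geography), cf. §4b. -/

/-- **Summary of the sandwich**: `HC → AnDistinct → An` and, given `V`, `An → HC`. [folklore] -/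
theorem anchorExistenceDistinct_iff_hodgeConjecture_of_variationalHodge (hV : VariationalHodge) :
    AnchorExistenceDistinct ↔ _root_.HodgeConjecture :=
  ⟨fun h ↦ (anchorExistence_iff_hodgeConjecture_of_variationalHodge hV).mp
      (anchorExistence_of_anchorExistenceDistinct h),
    anchorExistenceDistinct_of_hodgeConjecture⟩

/-! ### `s₀ = s₁` is exactly the Hodge conjecture at `(X, c)` -/

/-- `Spec ℂ` has exactly one complex point: an `Over`-morphism `s : Spec ℂ ⟶ Spec ℂ` over `Spec ℂ`
satisfies `s.left ≫ ε = ε` for the (iso) structure map `ε`. [folklore] -/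
theorem subsingleton_complexPoints_specOver : Subsingleton (ComplexPoints (specOver ℂ ℂ)) := by
  haveI := CurveNet.isIso_specOver_self_hom ℂ
  refine ⟨fun a b ↦ Over.OverMorphism.ext ?_⟩
  rw [← cancel_mono (specOver ℂ ℂ).hom, Over.w a, Over.w b]

namespace AnchorDatum

variable {n p : ℕ} {X : SchemeOver ℂ} {c : complexBetti X (2 * p)}

/-- **Anchoring at the fibre that carries `c` gives nothing**: in a datum with `s₀ = s₁` the class
`c = e^*(A|_{𝒳_{s₁}})` is already algebraic (`IsoInvariance` along `e`). [cite: Fulton1998, §19.1] -/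
theorem mem_algebraicClasses_of_eq {𝒳 S : SchemeOver ℂ} (f : 𝒳 ⟶ S) (s₁ s₀ : ComplexPoints S)
    (e : X ≅ fiberOver f s₁) (A : complexBetti 𝒳 (2 * p))
    (hAc : complexBetti.map e.hom (2 * p) (complexBetti.map (fiberι f s₁) (2 * p) A) = c)
    (hs₀ : complexBetti.map (fiberι f s₀) (2 * p) A ∈ algebraicClasses (fiberOver f s₀) p)
    (h : s₀ = s₁) : c ∈ algebraicClasses X p := by
  subst h
  rw [← hAc]
  exact anchorTransport_isoInvariance_proof e p _ hs₀

/-- **Over a base with a single complex point an anchor datum forces `c` algebraic** (e.g. the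
constant family over `Spec ℂ`, `subsingleton_complexPoints_specOver`). [cite: Fulton1998, §19.1] -/
theorem mem_algebraicClasses_of_subsingleton {𝒳 S : SchemeOver ℂ} [Subsingleton (ComplexPoints S)]
    (f : 𝒳 ⟶ S) (s₁ s₀ : ComplexPoints S) (e : X ≅ fiberOver f s₁) (A : complexBetti 𝒳 (2 * p))
    (hAc : complexBetti.map e.hom (2 * p) (complexBetti.map (fiberι f s₁) (2 * p) A) = c)
    (hs₀ : complexBetti.map (fiberι f s₀) (2 * p) A ∈ algebraicClasses (fiberOver f s₀) p) :
    c ∈ algebraicClasses X p :=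
  mem_algebraicClasses_of_eq f s₁ s₀ e A hAc hs₀ (Subsingleton.elim _ _)

/-- **The constant-family clause of the crux is EXACTLY the Hodge conjecture at `(X, c)`**: an anchor
datum over the base `Spec ℂ` exists iff `c` is algebraic (`→`: one complex point, so `s₀ = s₁`;
`←`: the constant family `X ⟶ Spec ℂ`, as in `anchorTransport_anchor_of_mem_algebraicClasses`).
[cite: CharlesSchnell2014Notes, Conj. 11.3.1] -/
theorem over_specOver_iff (hX : IsSmoothProjective n X) (hc : IsRationalClass c)
    (hpp : IsOfHodgeType n X (2 * p) p p c) :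
    (∃ (𝒳 : SchemeOver ℂ) (f : 𝒳 ⟶ specOver ℂ ℂ) (s₁ s₀ : ComplexPoints (specOver ℂ ℂ))
      (e : X ≅ fiberOver f s₁) (A : complexBetti 𝒳 (2 * p)),
      IsSmoothProjectiveFamily f n ∧ IrreducibleSpace (specOver ℂ ℂ).left ∧
      AlgebraicGeometry.Smooth (specOver ℂ ℂ).hom ∧
      (∀ s : ComplexPoints (specOver ℂ ℂ), IsRationalClass (complexBetti.map (fiberι f s) (2 * p) A) ∧
        IsOfHodgeType n (fiberOver f s) (2 * p) p p (complexBetti.map (fiberι f s) (2 * p) A)) ∧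
      complexBetti.map e.hom (2 * p) (complexBetti.map (fiberι f s₁) (2 * p) A) = c ∧
      complexBetti.map (fiberι f s₀) (2 * p) A ∈ algebraicClasses (fiberOver f s₀) p) ↔
    c ∈ algebraicClasses X p := by
  haveI := subsingleton_complexPoints_specOver
  refine ⟨fun ⟨𝒳, f, s₁, s₀, e, A, _, _, _, _, hAc, hs₀⟩ ↦
    mem_algebraicClasses_of_subsingleton f s₁ s₀ e A hAc hs₀, fun halg ↦ ?_⟩
  haveI : ∀ s : AlgPoints (specOver ℂ ℂ) ℂ, IsIso (fiberι (toSpecOver X) s) := isIso_fiberι_toSpecOver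
  refine ⟨X, toSpecOver X, 𝟙 _, 𝟙 _, (asIso (fiberι (toSpecOver X) (𝟙 _))).symm, c,
    isSmoothProjectiveFamily_toSpecOver hX, irreducibleSpace_specOver_left, smooth_specOver_hom,
    fun s ↦ ⟨hc.pullback _, hpp.map_of_iso (asIso (fiberι (toSpecOver X) s))⟩, ?_, ?_⟩
  · change (complexBetti.map (asIso (fiberι (toSpecOver X) (𝟙 _))).hom (2 * p) ≫
      complexBetti.map (asIso (fiberι (toSpecOver X) (𝟙 _))).inv (2 * p)) c = c
    rw [← complexBetti.map_comp, Iso.inv_hom_id, complexBetti.map_id]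
    rfl
  · exact anchorTransport_isoInvariance_proof (asIso (fiberι (toSpecOver X) (𝟙 _))) p _ halg

end AnchorDatum

/-! ## §4 Line `Sketch` (lead prover-line-stmt-HodgeConjecture-1077-0): stub-by-stub audit

No `-- Targets` were handed over (payload `targets = []`, `stuck_stubs = []`).  Audit of the seven
stubs of `Cruxes/AnchorExistence/Lines/Sketch.lean` (all statements read symbol by symbol):

* `anchorExistence_stub_lefschetzOneOne : lefschetzOneOne_rational` and
  `anchorExistence_stub_hardLefschetz : ∀ n X, nonempty_hardLefschetzNFold n X` — tier-0 named facts;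
  both carry the guard `IsSmoothProjective n X →` INSIDE the fact (`nonempty_hardLefschetzNFold n X :=
  IsSmoothProjective n X → Nonempty (HardLefschetzNFold n X)`), so the unguarded `∀ n X` is not junk-false.
  The structure `HardLefschetzNFold` quantifies its bidegree clauses over all `(p,q)` including
  `p + q ≠ k`; harmless since `hodgePQ k p q = ⊥` there (`hodgePQ_eq_bot_of_ne`).
* `anchorExistence_stub_buskinSquareCM : Buskin2019_hodgeConjectureFor_square_of_CM` — theorem in print
  (Huybrechts 2019 Cor. 0.4(ii)); `HasComplexMultiplication` is faithful for genuine K3 surfaces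
  (`End_Hdg(H²) = End(NS) × K`, `Hom_Hdg(T, NS) = 0`), no junk instance found.
* `anchorExistence_stub_k3SquareFacts` — conjunction of four named facts, each guarded
  (`hodgeIndex_surface X := IsSmoothProjective 2 X → …`; the K3 facts by `IsK3Surface S →`;
  `Grothendieck1969_supportedClasses_le_hodgeConiveau` by `IsSmoothProjective n X →`, stated per Hodge
  model with the CONIVEAU (sum of `(a,b)`, `a,b ≥ s`) not a single type — correctly).
* `anchorExistence_k3Square_floor_of_ratEnd` — HC for `S × S` in degree 4 when `End_Hdg(T(S)_ℚ) = ℚ`: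
  true in print (Künneth: Hodge classes in `H² ⊗ H²` are `NS ⊗ NS ⊕ ℚ·π_T`, `π_T = [Δ] −` algebraic
  parts).  The encoding `hQ` of "`End_Hdg T = ℚ`" through `ℂ`-linear `f` preserving rationality and all
  types is faithful (an `f` acting on `T_ℂ` by an irrational scalar does not preserve rational classes).
* `anchorExistence_k3Square_anchor_of_realMult` — the line's heart.  TRUE IN PRINT and not cheaply
  attackable: for `K = End_Hdg(T_ℚ)` totally real `≠ ℚ`, `m = dim_K T ≥ 3` (van Geemen, arXiv:math/0609839 = Michigan Math. J. 56 (2008), §2 Lemma "no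
  `m = 2`" and the Proposition on p. 6: `(m − 2)`-dimensional families, `F ⊂ End_Hod` along them — READ),
  the `(NS(S), K)`-polarised locus is an orthogonal-type Shimura variety of dimension `m − 2 ≥ 1` on
  which CM points are dense; monodromy commutes with `K` and is finite on `NS(S)`, so after a finite
  étale base change every rational `(2,2)` class of `S × S` (`= NS⊗NS ⊕ K ⊕ H⁰⊗H⁴ ⊕ H⁴⊗H⁰`) is invariant
  and extends to the total space by the theorem of the fixed part, staying `(2,2)` at every point of the
  RM locus.  `¬hQ ∧ ¬HasComplexMultiplication ⇒` RM (Zarhin) has no junk escape (checked above).  Cost: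
  moduli of lattice-polarised K3 surfaces with level structure as smooth quasi-projective `ℂ`-schemes +
  fixed-part theorem on real carriers — far beyond one cycle; no disproof angle.
* `anchorExistence_anchor_offK3Squares` — the declared complement; HC-sandwiched exactly like the crux
  (`AnchorDatum.of_mem_algebraicClasses` / `AnchorDatum.mem_algebraicClasses_of_fiberIso`): unfalsifiable
  short of `¬HC`, unprovable short of HC off the few sectors with an independent anchor theory.
JOINT SUFFICIENCY: the composition `anchorTransport_anchorExistence_proof` is kernel-checked (sorry only
in the stubs); no gap is smuggled.  VERDICT for the lead: no stub is false or misstated; the line's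
provable content this decade is `floor_of_ratEnd` (Künneth bookkeeping on real carriers, cf. the
NikulinTwinTransport `Square*` files) — the RM stub and the complement are where it will stall.
-/

/-! ## §4b Strategic pressure points for the INFORMAL crux (anchor = member where algebraicity is KNOWN)

The formal crux cannot see "known"; the route's own kill criterion for the STRATEGY is "a Hodge-locus
component through `(X, c)` meeting no member where the class is algebraic by any known means".  Two
candidates, recorded for the planner (pages read this session from the materialised arXiv text; the
held-book index was unavailable, `lit` rc 75):

1. RANK-TWO ATTRACTOR POINTS (Candelas–de la Ossa–Elmi–van Straten, arXiv:1912.06146 = JHEP 2020(10)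
   202).  For the one-parameter Hulek–Verrill / AESZ34 family `X_φ` of Calabi–Yau threefolds
   (`h^{2,1} = 1`), at `φ = −1/7` and `φ = 33 ± 8√17` the rational Hodge structure splits,
   `H³(X, ℚ) = Λ_ℚ ⊕ Λ^⊥_ℚ` (p. 5), the projector `σ` being a class in `H^{3,3}(X × X, ℚ)` "which,
   according to the Hodge Conjecture, can be represented by a 3-cycle `S`" (p. 6); "We have not observed
   this directly in the geometry of the manifold" (p. 9), "Standard conjectures (the Hodge conjecture
   and the Tate conjecture) imply that there exists a geometrical explanation which, once identified,
   would lead to a rigorous proof" (§6, p. 22).  CAVEAT: the splitting itself rests on "overwhelming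
   evidence" (periods to high precision + Frobenius factorisations), not on a proof (p. 22).  Granting
   it: the splitting locus in the `φ`-line is finite (proper closed, monodromy irreducible; the authors
   conjecture finiteness in general, p. 7), so `(X × X, σ)` — or `(E × X, graph)` with the elliptic curve
   `E = T_{Λ^⊥}` of p. 5 — is a RIGID pair; by tightness (`AnchorDatum.mem_algebraicClasses_of_fiberIso`,
   ideator notes §1) `An` collapses to `HC` there, `X_{−1/7}` is neither CM nor Fermat, and no cycle is
   known.  Home: summit card `two-attractor-transcendence-test`.
2. WEIL CLASSES IN DIMENSION 6 (rigorous Hodge classes).  On abelian sixfolds of Weil type the Hodge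
   locus of a Weil class is the whole Weil locus (positive-dimensional, CM points dense), yet
   algebraicity is known at NO member outside the special fields/discriminants treated by Schoen-type
   constructions (cf. this summit's cruxes `WeilSixfoldsSqrtMinus7`, `WeilTenfoldsSqrtMinus11`): for the
   remaining `(K, disc)` the informal `An` has no anchor today, while the formal `An` is again just HC.
Neither is a refutation of the formal crux; both say the anchor strategy adds nothing on these sectors.
-/

/-! ## §5 Summit-level junk probe (recorded, not pursued)

`IsOfHodgeType n X k p q c := ∃ A : HodgeModel n X, A.pullback k c ∈ A.hodgePQ k p q`.  An EXOTIC Hodge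
model with a larger `H^{p,p}` would make more classes "Hodge", hence could make `HodgeConjecture` — and
with it `AnchorExistence` — false for the wrong reason.  The freedom in `HodgeModel`: (i) the complex
structure is pinned by `IsAnalytification` (regular functions pull back to holomorphic ones; a holomorphic
homeomorphism of `n`-dimensional complex manifolds is biholomorphic — `IsAnalytification.unique`);
(ii) the de Rham comparison family is natural for all smooth maps of manifolds charted on the model
space, hence differs from the standard one by a scalar per degree (Thom realisability + universal
coefficients), which does not move `e(H^{p,q})`; (iii) `isInternal_hodgePQ` then fixes the decomposition.
So no exotic model is constructible from a symmetry (conjugating the charts violates (i); rescaling the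
comparison is absorbed by (ii)).  Decisively, the tree PROVES model independence:
`hodgePQ_independent_of_hodgeModel_holds` (consumed in `MiddleDimensionReductionHolds`), so `∃` and `∀`
over models agree and an exotic model cannot enlarge the Hodge classes.  Conclusion: the `∃`-over-models encoding offers no disproof route; `nonempty_hodgeModel_holds`
is axiom-free (checked: `propext`, `Classical.choice`, `Quot.sound` only behind this file's theorems).
-/

/-! ## §6 Near-misses and open witnesses

* WITNESS WANTED (for `anchorExistenceWithoutIsOfHodgeType_false_of`): a smooth projective `X` on the
  tree's carriers with a rational class `c ∈ H²(X(ℂ); ℂ)` and a PROOF of `¬ IsOfHodgeType 2 X 2 1 1 c`.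
  Candidates: the Fermat quartic surface (eigenclasses of type `(2,0)` exist in
  `FermatEigenspaceHodgeDecomposition`, but "rational class with non-zero `(2,0)`-component is not `(1,1)`"
  needs the directness of the decomposition inside ONE model plus model independence); a product of two
  elliptic curves.  Not attempted this cycle (no carrier-level Hodge numbers are computed anywhere in the
  tree; sibling disprovers leave the same hypothesis open).
* NOT FORMALISED: "without `IrreducibleSpace S.left` the crux is trivially TRUE" (`X ⊔ X ⟶ Spec ℂ ⊔ Spec ℂ`,
  `A = (c, 0)`): needs binary coproducts in `SchemeOver ℂ` with `ComplexPoints`/`complexBetti` of a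
  coproduct — absent.  The prover's `AnchorTransportVariationalHodgeTrivialFamily` records the same
  observation for `V`.
* NOT FORMALISED: "`Smooth S.hom` is idle" (pull back along a resolution / the normalisation of an
  irreducible base, which is again irreducible): needs resolution of singularities of the base as a
  `ℂ`-scheme morphism with connected source — absent; information for the planner only.
-/

end Summit.HodgeConjecture.HodgeConjecture.Cruxes.AnchorExistence.Disproof

end
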